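import Summits.BirchSwinnertonDyer.Rank1Residual.AdditivePotMult.PotMultRankOneKatoCertificate
import Summits.BirchSwinnertonDyer.Rank1Residual.AdditivePotMult.PotMultChiBranchPrimePrep
import Summits.BirchSwinnertonDyer.Rank1Residual.Additive.SemistableTwistAnalytic
import Summits.BirchSwinnertonDyer.Rank1Residual.Additive.SemistableTwistAnalyticOdd
import Summits.BirchSwinnertonDyer.Rank1Residual.Additive.GordChiBranchKatoComponent
import Summits.BirchSwinnertonDyer.Rank1Residual.Additive.ChiBranchLowerTransportPotMult
import Summits.BirchSwinnertonDyer.Rank1Residual.Additive.CycLeadingTermDvdConverse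
import Summits.BirchSwinnertonDyer.Rank1Residual.Additive.CycLeadingTermDvdIff
import Summits.BirchSwinnertonDyer.Rank1Residual.GaloisImage.JWitnessTowerSurjectivity
import Literature.NumberTheory.EllipticCurves.LeadingTermPPartProofs
import HarnessLib

/-!
# Route `AdditiveBranchIMC` (rung K1), crux `MultLower` (item `stmt-BirchSwinnertonDyer-19359`):
# in analytic rank `0` on cell (M) the `T = 0` input UPGRADES to the full `ω^{(p−1)/2}`-branch main
# conjecture of `E` on the tower-surjective rows — Λ-adic ⟺ `T = 0` ⟺ Miller there

Cell `bsd-addord`, seat `bsd-addord-k1-c4` (gen 2). The (M)-twin of k1-c2's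
`AdditiveBranchIMCGordTwoRankZeroLambdaAdic{,Odd,Iff}` (crux 2, cell (G-ord, `e = 2`)), with the good
ordinary twist datum replaced by a MULTIPLICATIVE one. HONEST FRAMING: nothing here proves the
Birch–Swinnerton-Dyer conjecture, the crux, or any main conjecture; every published input is an explicit
named-fact binder — Kato 2004 Thm. 17.4 (3) read on the `ω^{(p−1)/2}`-component at a semistable `p`
(`hK` = `Wuthrich2014.kato_halfEigenCharIdeal_dvd_cyclotomicPrime_of_surjective`, a READING flagged as such
by referee A), Pal 2012 Thm. 3.2 (`hPal`, even branch only), modularity (`hmod`), Delbourgo 1998 Prop. 4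
in both transcriptions (`hDel`, `hDelX`), GZK, `hmodD`; the main-conjecture LOWER input stays DISPLAYED;
cell (M) stays CONSTRUCTION-shaped; nothing booked. THEOREMS ONLY.

## What this file proves

Let `W = E` be globally minimal, `p` an odd additive potentially multiplicative prime (`E = V ⊗ χ_{p*}`
with `V` multiplicative at `p`), `ord_{s=1} L(E,s) = 0`, `ρ_{E,p^∞}` tower-surjective. For a multiplicative
twist datum `(V, f, ϖ)` (`C • V^{(p*)} = W`, `f` the newform of `V`, `a_p(f) = ±1`, `ϖ·Ω_V = Ω⁺_f` resp.
`ϖ·|Ω⁻(V)| = Ω⁻_f`) and a dual datum `D` of `Sel_{p^∞}(E/ℚ_∞)` at a cyclotomic `κ/γ`: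

* §1 `charIdeal_eq_span_kato_of_chiBranchLowerLeadingTerm_rankZero_mult` (`p ≡ 1 (mod 4)`; the odd branch
  `p ≡ 3 (mod 4)` is the sibling file `AdditiveBranchIMCMultLowerLambdaAdicOdd.lean`): the `T = 0` lower input
  `ChiBranchLowerLeadingTerm[Odd]At W p` + Kato's Λ-adic element on the branch
  (`AdditivePotMult.isTorsion_and_exists_iota_eq_of_katoHalf`, `ι g_K = u·ϖ·B`, `B` the one-term branch
  series with `a_p = ±1`, `B(0) = e·∑(a/p)[a/p]^±`, `e ∈ ℤ_p^×`) ⟹ `char_Λ X(E/ℚ_∞) = (g_K)`: the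
  Iwasawa main conjecture for `E` over `ℚ_∞` on the branch, INTEGRALLY. Mechanism (elementary, k1-c2's):
  `g_K = h·f₁`, `(f₁) = char X`; at `T = 0`, `u ϖ e S = h(0) f₁(0) = h(0) c ϖ S` with `ϖ S ≠ 0` because
  `L(E,1) = ±ϖ S Ω_E·(unit) ≠ 0` (Birch–Pal, rank `0`); so `h(0) c = u e ∈ ℤ_p^×`, `h ∈ Λ^×`.
* §2 the Λ-adic lower input's conclusion for every tower-surjective multiplicative datum
  (`branchLowerDivisibility_of_chiBranchLowerLeadingTerm_rankZero_mult_towerSurj`), the bookkeeping iff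
  `MissingLowerBoundAt W p ↔ ChiBranchLowerLeadingTermAt W p` on X4(M), `p ≥ 5`, and the upgrade from the
  crux's OWN conclusion (`charIdeal_eq_span_kato_of_missingLowerBoundAt_rankZero_mult`: via the tree's `T = 0` iffs
  `missingLowerBoundAt_iff_cycLeadingTermDvdAt_of_potMult_of_five_le`, `cycLeadingTermDvdAt_iff_cycLowerLeadingTermAt`,
  `ClassX4M.cycLowerLeadingTermAt_iff_chiBranchLower[Odd]`).

Consequently, on X4(M) ∩ {ρ_{E,p^∞} onto} in analytic rank `0` (`p ≥ 5`), proving the rank-`0` lower half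
of `BSD(E,p)` (what crux 19359 asserts there) is EXACTLY as hard as proving the cyclotomic main
conjecture of `E` over `ℚ_∞` integrally on the branch — the Λ-adic child of the crux shape
(`AdditiveBranchIMCMultLowerCruxShape.lean`) is not stronger than the crux on these rows.

References: K. Kato, Astérisque 295 (2004) Thm. 17.4 (3) [Kato2004Asterisque]; C. Wuthrich, Doc. Math.
19 (2014) §3, Cor. 19 [Wuthrich2014]; B. Mazur, J. Tate, J. Teitelbaum, Invent. Math. 84 (1986) §I.10,
§I.13–I.14 [MazurTateTeitelbaum1986Invent]; V. Pal, Proc. AMS 140 (2012) Thm. 3.2 [Pal2012];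
D. Delbourgo, Compositio Math. 113 (1998) Prop. 4, §2.2 Lemma (ii) [Delbourgo1998]; L. C. Washington,
Introduction to Cyclotomic Fields, §13.2 [Washington1997].
-/

set_option autoImplicit false
set_option linter.dupNamespace false

noncomputable section

open scoped Classical MatrixGroups ModularForm

open CongruenceSubgroup WeierstrassCurve NumberField IsDedekindDomain Rat.HeightOneSpectrum
  Literature.NumberTheory.EllipticCurves
  Literature.NumberTheory.EllipticCurves.ModularForms
  Literature.NumberTheory.EllipticCurves.Rank1Residual
  Literature.NumberTheory.EllipticCurves.Rank1Residual.Typed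
  Literature.NumberTheory.GaloisRepresentations

namespace Summit.BirchSwinnertonDyer.BirchSwinnertonDyer.Theorems.AdditiveBranchIMCMultLowerLambdaAdic

open Summit.BirchSwinnertonDyer.Rank1Residual.Additive
open Summit.BirchSwinnertonDyer.Rank1Residual.AdditivePotMult

variable {W : WeierstrassCurve ℚ} [W.IsElliptic] [W.IsGloballyMinimal] {p : ℕ} [hp : Fact p.Prime]

/-! ## §1 Even branch (`p ≡ 1 (mod 4)`): the `T = 0` lower input + Kato ⟹ the full branch main
conjecture of `E`, at a MULTIPLICATIVE twist datum -/

/-- **The full main conjecture on the `ω^{(p−1)/2}`-branch from the `T = 0` lower input, analytic rank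
`0`, cell (M), even branch** (per datum). `W = E` globally minimal, additive at `p ≡ 1 (mod 4)`,
`ord_{s=1} L(E,s) = 0`, `ρ_{E,pⁿ}` onto for all `n`; `(V, f, ϖ)` a MULTIPLICATIVE twist datum
(`C • V^{(p)} = W`, `V` multiplicative at `p`, `ϖ·Ω_V = Ω⁺_f`), `D` a dual datum of `Sel_{p^∞}(E/ℚ_∞)`.
IF `ChiBranchLowerLeadingTermAt W p` holds, then `char_Λ X(E/ℚ_∞) = (g_K)` with
`ι g_K = u·ϖ·L⁺_p(f, a_p, ω^{(p−1)/2}, T)` (`a_p = ±1` the split/non-split sign), `u ∈ ℤ_p^×`.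
Inputs by name: Kato's half-eigen reading `hK`, Pal `hPal` + modularity `hmod` (Birch: `ϖ S ≠ 0` in rank
`0`), principality of `char_Λ`. [cite: Kato2004Asterisque, Thm. 17.4 (3) (p. 273)]
[cite: Wuthrich2014, §3 (p. 390), Cor. 19 (p. 398)] [cite: MazurTateTeitelbaum1986Invent, §I.14]
[cite: Pal2012, Thm. 3.2] [cite: Washington1997, §13.2] -/
theorem charIdeal_eq_span_kato_of_chiBranchLowerLeadingTerm_rankZero_mult
    (hK : Wuthrich2014.kato_halfEigenCharIdeal_dvd_cyclotomicPrime_of_surjective)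
    (hPal : Pal2012.thm32_sqrt_mul_realPeriodRat_twist_eq_of_prime_one_mod_four)
    (hmod : hasEntireLFunction_rat)
    (hadd : Addv W p) (hr : W.analyticRank = 0)
    (htower : ∀ n : ℕ, W.HasSurjectiveModNGaloisRep (p ^ n : ℕ))
    (hLow : ChiBranchLowerLeadingTermAt W p)
    (V : WeierstrassCurve ℚ) [V.IsElliptic] [V.IsGloballyMinimal]
    {κ : ZpExtension ℚ p} {γ : Field.absoluteGaloisGroup ℚ} {N : ℕ} [NeZero N]
    {f : CuspForm (Gamma0 N) 2} (hp1 : p % 4 = 1)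
    (hCW : ∃ C : VariableChange ℚ, C • V.quadraticTwist (p : ℚ) = W) (hV : Mult V p)
    (hκ : κ.IsCyclotomic) (hγ : κ.IsTopGenerator γ) (hcv : IsCyclotomicVariable p γ)
    (hf : IsNewformOf V f) (D : W.SelmerDualData κ γ) (ϖ : ℚ)
    (hϖ : (ϖ : ℝ) * V.realPeriodRat = plusPeriod f) :
    ∃ (B : PowerSeries ℚ_[p]) (e : ℤ_[p]ˣ),
      ((V.HasSplitMultiplicativeReductionAtPrime p ∧
          B = padicLFunctionPlusBranchMult f (1 : ℚ_[p]) (p / 2)) ∨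
        (¬ V.HasSplitMultiplicativeReductionAtPrime p ∧
          B = padicLFunctionPlusBranchMult f (-1 : ℚ_[p]) (p / 2))) ∧
      PowerSeries.constantCoeff B = ((e : ℤ_[p]) : ℚ_[p]) * (legendrePlusSymbolSum f p : ℚ_[p]) ∧
      ∃ gK ∈ D.charIdeal, ∃ u : ℤ_[p]ˣ, D.charIdeal = Ideal.span {gK} ∧
        iwasawaToPowerSeries p gK = PowerSeries.C (((u : ℤ_[p]) : ℚ_[p]) * (ϖ : ℚ_[p])) * B := by
  have hp2 : p ≠ 2 := by rintro rfl; norm_num at hp1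
  have hpne : (p : ℚ) ≠ 0 := Nat.cast_ne_zero.mpr hp.out.ne_zero
  have heven : Even (p / 2) := ⟨p / 4, by omega⟩
  -- the tower of `E` is the tower of `V` (twisting by `χ_p`)
  have hsurjV : ∀ n : ℕ, V.HasSurjectiveModNGaloisRep (p ^ n : ℕ) := fun n ↦
    (Summit.BirchSwinnertonDyer.Rank1Residual.GaloisImage.hasSurjectiveModNGaloisRep_pow_iff_of_model_twist
      V p hpne hCW n).mp (htower n)
  -- the branch series of the reduction type, with its constant term
  obtain ⟨B, e, hdisj, hB0⟩ := exists_halfBranchMult_even p hp2 heven hV hf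
  obtain ⟨C, hC⟩ := hCW
  have hC' : C • V.quadraticTwist ((-1 : ℚ) ^ (p / 2) * p) = W := by
    rw [Even.neg_one_pow heven, one_mul]; exact hC
  -- Kato's element, Λ-adically, on the branch
  have hϖ' : (if Even (p / 2) then (ϖ : ℝ) * V.realPeriodRat = plusPeriod f
      else (ϖ : ℝ) * V.imaginaryPeriodRat = minusPeriod f) := by
    rw [if_pos heven]; exact hϖ
  obtain ⟨-, gK, hgK, u, hιgK⟩ :=
    isTorsion_and_exists_iota_eq_of_katoHalf hK hp2 V C hC' hsurjV hκ hγ hcv hf D B hdisj ϖ hϖ'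
  -- record the shape of `B` (no good ordinary case: `V` is multiplicative)
  have hnotord : ¬ IsOrdinaryAt V p := fun h ↦
    (WeierstrassCurve.HasGoodReduction.not_hasMultiplicativeReduction (R := ℤ_[p]) h.1) hV
  have hBshape : (V.HasSplitMultiplicativeReductionAtPrime p ∧
        B = padicLFunctionPlusBranchMult f (1 : ℚ_[p]) (p / 2)) ∨
      (¬ V.HasSplitMultiplicativeReductionAtPrime p ∧
        B = padicLFunctionPlusBranchMult f (-1 : ℚ_[p]) (p / 2)) := by
    rcases hdisj with ⟨hord, -⟩ | ⟨hs, hB⟩ | ⟨-, hns, hB⟩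
    · exact absurd hord hnotord
    · exact Or.inl ⟨hs, by rw [hB, if_pos heven]⟩
    · exact Or.inr ⟨hns, by rw [hB, if_pos heven]⟩
  refine ⟨B, e, hBshape, hB0, ?_⟩
  -- a generator `f₁` of `char X`
  haveI : (Module.charIdeal (IwasawaAlgebra p) D.X).IsPrincipal := charIdeal_isPrincipal_holds p D.X
  obtain ⟨f₁, hf₁⟩ := Submodule.IsPrincipal.principal (Module.charIdeal (IwasawaAlgebra p) D.X)
  have hf₁mem : f₁ ∈ D.charIdeal := by
    change f₁ ∈ Module.charIdeal (IwasawaAlgebra p) D.X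
    rw [hf₁]
    exact Ideal.mem_span_singleton_self f₁
  -- the `T = 0` lower input at `f₁`: `f₁(0) = c·ϖ·S`
  obtain ⟨c, hc⟩ := hLow V hp1 ⟨C, hC⟩ (Or.inr hV) hκ hγ hcv hf D ϖ hϖ f₁ hf₁mem
  -- `gK = h · f₁`
  have hgK' : gK ∈ Ideal.span {f₁} := by
    change gK ∈ Module.charIdeal (IwasawaAlgebra p) D.X at hgK
    rwa [hf₁] at hgK
  obtain ⟨h, hh⟩ := Ideal.mem_span_singleton'.mp hgK'
  -- constant terms: `gK(0) = u ϖ e S` and `gK(0) = h(0) f₁(0) = h(0) c ϖ S`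
  have h0 := congrArg PowerSeries.constantCoeff hιgK
  rw [constantCoeff_iwasawaToPowerSeries, map_mul, PowerSeries.constantCoeff_C, hB0] at h0
  have hprod : ((PowerSeries.constantCoeff gK : ℤ_[p]) : ℚ_[p]) =
      ((PowerSeries.constantCoeff h : ℤ_[p]) : ℚ_[p]) *
        ((PowerSeries.constantCoeff f₁ : ℤ_[p]) : ℚ_[p]) := by
    rw [← hh, map_mul, PadicInt.coe_mul]
  -- `ϖ S ≠ 0` in rank `0` (Birch + Pal: `L(E,1) = ±ϖ S Ω_E`)
  have hϖS : (ϖ : ℚ_[p]) * (legendrePlusSymbolSum f p : ℚ_[p]) ≠ 0 := by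
    obtain ⟨ε, -, hL⟩ :=
      entireLFunction_one_eq_of_twist p hPal hmod hp1 V W ⟨C, hC⟩ (Or.inr hV) hadd hf ϖ hϖ
    have hL0 : W.entireLFunction 1 ≠ 0 := (W.analyticRank_eq_zero_iff_holds (hmod W)).mp hr
    have hq : (ϖ * legendrePlusSymbolSum f p : ℚ) ≠ 0 := by
      intro hz
      apply hL0
      rw [hL, hz, mul_zero, Rat.cast_zero, zero_mul]
    have hq' : ((ϖ * legendrePlusSymbolSum f p : ℚ) : ℚ_[p]) ≠ 0 := by exact_mod_cast hq
    simpa [Rat.cast_mul] using hq'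
  -- hence `h(0)·c = u·e`, a unit of `ℤ_p`
  have hkey : ((PowerSeries.constantCoeff h : ℤ_[p]) : ℚ_[p]) * (c : ℚ_[p]) =
      ((u : ℤ_[p]) : ℚ_[p]) * ((e : ℤ_[p]) : ℚ_[p]) := by
    have e1 : ((PowerSeries.constantCoeff h : ℤ_[p]) : ℚ_[p]) * (c : ℚ_[p]) *
        ((ϖ : ℚ_[p]) * (legendrePlusSymbolSum f p : ℚ_[p])) =
        ((u : ℤ_[p]) : ℚ_[p]) * ((e : ℤ_[p]) : ℚ_[p]) *
          ((ϖ : ℚ_[p]) * (legendrePlusSymbolSum f p : ℚ_[p])) := by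
      have e2 := h0
      rw [hprod, hc] at e2
      -- e2 : h(0) * (c * ϖ * S) = u * ϖ * (e * S)
      linear_combination e2
    exact mul_right_cancel₀ hϖS e1
  have hunitZ : IsUnit (PowerSeries.constantCoeff h * c) := by
    have hcoe : (((PowerSeries.constantCoeff h * c : ℤ_[p])) : ℚ_[p]) =
        (((u * e : ℤ_[p]ˣ) : ℤ_[p]) : ℚ_[p]) := by
      rw [PadicInt.coe_mul, hkey, Units.val_mul, PadicInt.coe_mul]
    have heq : PowerSeries.constantCoeff h * c = ((u * e : ℤ_[p]ˣ) : ℤ_[p]) := PadicInt.ext hcoe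
    rw [heq]
    exact Units.isUnit _
  have hunit_h : IsUnit h :=
    (PowerSeries.isUnit_iff_constantCoeff (φ := h)).mpr (isUnit_of_mul_isUnit_left hunitZ)
  -- so `(f₁) = (gK)`
  have hspan : Ideal.span {f₁} = Ideal.span ({gK} : Set (IwasawaAlgebra p)) := by
    rw [← hh]
    exact (Ideal.span_singleton_mul_left_unit hunit_h f₁).symm
  refine ⟨gK, hgK, u, ?_, hιgK⟩
  change Module.charIdeal (IwasawaAlgebra p) D.X = _
  rw [hf₁]
  exact hspan

/-! ## §2 Consequences, even branch: the Λ-adic lower input at every tower-surjective multiplicative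
datum, and the upgrade from the crux's OWN conclusion on X4(M), `p ≥ 5` (odd branch: sibling file
`AdditiveBranchIMCMultLowerLambdaAdicOdd.lean`) -/

/-- **The Λ-adic LOWER input's conclusion holds at every tower-surjective multiplicative twist datum,
given the `T = 0` input in rank `0`, even branch** (`p ≡ 1 (mod 4)`): for every `g ∈ char_Λ X(E/ℚ_∞)`,
`ι g = ι h · (ϖ·B)` for some `h ∈ Λ`, `B = L⁺_p(f, ±1, ω^{(p−1)/2}, T)` — the shape of the conclusion of
the cell's conjecture `QuadraticBranchLowerDivisibilityAt V p` at the descended datum, so on these rows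
the Λ-adic / `T = 0` distinction in the crux shape of 19359 is EMPTY. [cite: Kato2004Asterisque, Thm. 17.4 (3) (p. 273)]
[cite: MazurTateTeitelbaum1986Invent, §I.14] [cite: Pal2012, Thm. 3.2] -/
theorem branchLowerDivisibility_of_chiBranchLowerLeadingTerm_rankZero_mult_towerSurj
    (hK : Wuthrich2014.kato_halfEigenCharIdeal_dvd_cyclotomicPrime_of_surjective)
    (hPal : Pal2012.thm32_sqrt_mul_realPeriodRat_twist_eq_of_prime_one_mod_four)
    (hmod : hasEntireLFunction_rat)
    (hadd : Addv W p) (hr : W.analyticRank = 0)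
    (htower : ∀ n : ℕ, W.HasSurjectiveModNGaloisRep (p ^ n : ℕ))
    (hLow : ChiBranchLowerLeadingTermAt W p)
    (V : WeierstrassCurve ℚ) [V.IsElliptic] [V.IsGloballyMinimal]
    {κ : ZpExtension ℚ p} {γ : Field.absoluteGaloisGroup ℚ} {N : ℕ} [NeZero N]
    {f : CuspForm (Gamma0 N) 2} (hp1 : p % 4 = 1)
    (hCW : ∃ C : VariableChange ℚ, C • V.quadraticTwist (p : ℚ) = W) (hV : Mult V p)
    (hκ : κ.IsCyclotomic) (hγ : κ.IsTopGenerator γ) (hcv : IsCyclotomicVariable p γ)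
    (hf : IsNewformOf V f) (D : W.SelmerDualData κ γ) (ϖ : ℚ)
    (hϖ : (ϖ : ℝ) * V.realPeriodRat = plusPeriod f) :
    ∃ B : PowerSeries ℚ_[p],
      ((V.HasSplitMultiplicativeReductionAtPrime p ∧
          B = padicLFunctionPlusBranchMult f (1 : ℚ_[p]) (p / 2)) ∨
        (¬ V.HasSplitMultiplicativeReductionAtPrime p ∧
          B = padicLFunctionPlusBranchMult f (-1 : ℚ_[p]) (p / 2))) ∧
      ∀ g ∈ D.charIdeal, ∃ h : IwasawaAlgebra p,
        iwasawaToPowerSeries p g = iwasawaToPowerSeries p h * (PowerSeries.C ((ϖ : ℚ) : ℚ_[p]) * B) := by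
  obtain ⟨B, e, hBshape, -, gK, -, u, hchar, hιgK⟩ :=
    charIdeal_eq_span_kato_of_chiBranchLowerLeadingTerm_rankZero_mult hK hPal hmod hadd hr htower hLow V
      hp1 hCW hV hκ hγ hcv hf D ϖ hϖ
  refine ⟨B, hBshape, fun g hg ↦ ?_⟩
  rw [hchar] at hg
  obtain ⟨k, hk⟩ := Ideal.mem_span_singleton'.mp hg
  refine ⟨k * PowerSeries.C (u : ℤ_[p]), ?_⟩
  have hιC : iwasawaToPowerSeries p (PowerSeries.C (u : ℤ_[p])) =
      PowerSeries.C (((u : ℤ_[p]) : ℤ_[p]) : ℚ_[p]) := by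
    rw [iwasawaToPowerSeries, PowerSeries.map_C]
    rfl
  rw [← hk]
  simp only [map_mul, hιgK, hιC]
  ring

/-- **X4(M), `r_an = 0`, `p ≥ 5`: the crux's conclusion and its `T = 0` input are ONE statement** —
`MissingLowerBoundAt W p ↔ ChiBranchLowerLeadingTermAt W p` at `p ≡ 1 (mod 4)`, composing the tree's
iffs `missingLowerBoundAt_iff_cycLeadingTermDvdAt_of_potMult_of_five_le` (Delbourgo 1998 Prop. 4 in both
transcriptions `hDel`/`hDelX`, GZK, modularity; `p ∤ c_p` automatic at `p ≥ 5`),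
`cycLeadingTermDvdAt_iff_cycLowerLeadingTermAt` and `ClassX4M.cycLowerLeadingTermAt_iff_chiBranchLower`
(`hPal`, `hmodD`). Bookkeeping. [cite: Delbourgo1998, Prop. 4 (p. 144), §2.2 Lemma (ii) (p. 139)]
[cite: Pal2012, Thm. 3.2] [cite: Miller2011LMS, Def. 1.1] -/
theorem missingLowerBoundAt_iff_chiBranchLowerLeadingTermAt_classX4M_rankZero
    (hDel : Delbourgo1998.prop4_rankZero_pow_dvd_constantCoeff)
    (hDelX : Delbourgo1998.prop4_rankZero_constantCoeff_eq_unit_mul_of_potMult)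
    (hPal : Pal2012.thm32_sqrt_mul_realPeriodRat_twist_eq_of_prime_one_mod_four)
    (hGZK : rank_eq_analyticRank_of_analyticRank_le_one) (hmod : hasEntireLFunction_rat)
    (hmodD : nonempty_modularParametrizationData)
    (hX : ClassX4M W p) (hp5 : 5 ≤ p) (hp1 : p % 4 = 1) (hr : W.analyticRank = 0) :
    MissingLowerBoundAt W p ↔ ChiBranchLowerLeadingTermAt W p :=
  (missingLowerBoundAt_iff_cycLeadingTermDvdAt_of_potMult_of_five_le W p hDel hDelX hGZK hmod hp5 hX.2.1
      hX.2.2 hr).trans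
    ((cycLeadingTermDvdAt_iff_cycLowerLeadingTermAt W p).trans
      (ClassX4M.cycLowerLeadingTermAt_iff_chiBranchLower hPal hmod hmodD hX hp1))

/-- **From the crux's own conclusion, even branch.** On a pair of X4(M) (`W` globally minimal, odd
additive potentially multiplicative `p ≥ 5`, `E[p]` irreducible) with `ρ_{E,p^∞}` tower-surjective,
`p ≡ 1 (mod 4)` and `r_an = 0`, the lower half `MissingLowerBoundAt W p` — what crux 19359 asserts there —
already gives the FULL branch main conjecture `char_Λ X(E/ℚ_∞) = (g_K)`,
`ι g_K = u·ϖ·L⁺_p(f, a_p, ω^{(p−1)/2}, T)`, at every multiplicative twist datum. So on these rows the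
rank-`0` `p`-part of BSD (lower half) and the integral main conjecture for `E` over `ℚ_∞` on the branch
are the SAME problem. Facts: `hK`, `hDel`, `hDelX`, `hPal`, `hGZK`, `hmod`, `hmodD`.
[cite: Kato2004Asterisque, Thm. 17.4 (3) (p. 273)] [cite: Delbourgo1998, Prop. 4 (p. 144)]
[cite: Pal2012, Thm. 3.2] [cite: Miller2011LMS, Def. 1.1] -/
theorem charIdeal_eq_span_kato_of_missingLowerBoundAt_rankZero_mult
    (hK : Wuthrich2014.kato_halfEigenCharIdeal_dvd_cyclotomicPrime_of_surjective)
    (hDel : Delbourgo1998.prop4_rankZero_pow_dvd_constantCoeff)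
    (hDelX : Delbourgo1998.prop4_rankZero_constantCoeff_eq_unit_mul_of_potMult)
    (hPal : Pal2012.thm32_sqrt_mul_realPeriodRat_twist_eq_of_prime_one_mod_four)
    (hGZK : rank_eq_analyticRank_of_analyticRank_le_one) (hmod : hasEntireLFunction_rat)
    (hmodD : nonempty_modularParametrizationData)
    (hX : ClassX4M W p) (hp5 : 5 ≤ p) (hp1 : p % 4 = 1) (hr : W.analyticRank = 0)
    (htower : ∀ n : ℕ, W.HasSurjectiveModNGaloisRep (p ^ n : ℕ))
    (hlow : MissingLowerBoundAt W p)
    (V : WeierstrassCurve ℚ) [V.IsElliptic] [V.IsGloballyMinimal]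
    {κ : ZpExtension ℚ p} {γ : Field.absoluteGaloisGroup ℚ} {N : ℕ} [NeZero N]
    {f : CuspForm (Gamma0 N) 2}
    (hCW : ∃ C : VariableChange ℚ, C • V.quadraticTwist (p : ℚ) = W) (hV : Mult V p)
    (hκ : κ.IsCyclotomic) (hγ : κ.IsTopGenerator γ) (hcv : IsCyclotomicVariable p γ)
    (hf : IsNewformOf V f) (D : W.SelmerDualData κ γ) (ϖ : ℚ)
    (hϖ : (ϖ : ℝ) * V.realPeriodRat = plusPeriod f) :
    ∃ (B : PowerSeries ℚ_[p]) (e : ℤ_[p]ˣ),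
      ((V.HasSplitMultiplicativeReductionAtPrime p ∧
          B = padicLFunctionPlusBranchMult f (1 : ℚ_[p]) (p / 2)) ∨
        (¬ V.HasSplitMultiplicativeReductionAtPrime p ∧
          B = padicLFunctionPlusBranchMult f (-1 : ℚ_[p]) (p / 2))) ∧
      PowerSeries.constantCoeff B = ((e : ℤ_[p]) : ℚ_[p]) * (legendrePlusSymbolSum f p : ℚ_[p]) ∧
      ∃ gK ∈ D.charIdeal, ∃ u : ℤ_[p]ˣ, D.charIdeal = Ideal.span {gK} ∧
        iwasawaToPowerSeries p gK = PowerSeries.C (((u : ℤ_[p]) : ℚ_[p]) * (ϖ : ℚ_[p])) * B :=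
  charIdeal_eq_span_kato_of_chiBranchLowerLeadingTerm_rankZero_mult hK hPal hmod hX.2.1 hr htower
    ((missingLowerBoundAt_iff_chiBranchLowerLeadingTermAt_classX4M_rankZero hDel hDelX hPal hGZK hmod hmodD
      hX hp5 hp1 hr).mp hlow) V hp1 hCW hV hκ hγ hcv hf D ϖ hϖ

end Summit.BirchSwinnertonDyer.BirchSwinnertonDyer.Theorems.AdditiveBranchIMCMultLowerLambdaAdic

end
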